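import Mathlib
import Summits.ValiantsHypothesis.ValiantsHypothesis.Theorems.FeketeSOSCharPSparseSOSStubTwoCuspHajos
import Summits.ValiantsHypothesis.ValiantsHypothesis.Theorems.FeketeSOSHard.Negative.SketchOrdSparsityWeak

/-!
# Crux `FeketeSOS.CharPSparseSOS` (stmt-ValiantsHypothesis-14989), line `Sketch` — the TRIVIAL exponent of
the two-cusp inequality (baseline for the load-bearing stub `stub_twoCuspInequality`)

The registered load-bearing stub asks for `min(δ_∞, δ_0)(P) ≤ C₀ (s+1)^{A₀} (Σ_i #supp g_i)^θ` with SOME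
`θ < 2`, for every non-zero fold `P = (Σ_{i<s} c_i g_i²) mod (X^p − 1)`.  This file proves the baseline
`θ = 2` (so the stub is exactly "any power saving over counting"):

* `card_support_fold_le` — folding modulo `X^p − 1` does not increase the number of monomials
  (`X^n ↦ X^{n mod p}`);
* `card_support_sos_fold_le` — `#supp P ≤ Σ_i (#supp g_i)²`;
* `twoCusp_depth_le_card_support_sq` — the lower-cusp depth alone already gives
  `D ≤ #supp P ≤ Σ_i (#supp g_i)² ≤ (Σ_i #supp g_i)²` (two-cusp Hajós `stub_twoCuspHajos` applied to `P`);
* `twoCuspInequality_theta_two` — the same in the real-number shape of the stub with `C₀ = 1, A₀ = 0, θ = 2`.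
-/

-- `Summit.ValiantsHypothesis.ValiantsHypothesis.…` is the tree's mandated single-conjunct layout (Sub = Summit).
set_option linter.dupNamespace false

namespace Summit.ValiantsHypothesis.ValiantsHypothesis.Theorems.CharPSparseSOSTwoCusp

open Polynomial Finset
open Summit.ValiantsHypothesis.ValiantsHypothesis.Theorems.FeketeSOSHard.Negative (socle_card_support_sum_le)

section Support

variable {K : Type*} [Field K]

/-- `X^p − 1` divides `X^n − X^(n mod p)`. -/
theorem tct_X_pow_sub_one_dvd (p n : ℕ) :
    (X : K[X]) ^ p - 1 ∣ X ^ n - X ^ (n % p) := by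
  have h : (X : K[X]) ^ (n % p) * ((X ^ p) ^ (n / p) - 1) = X ^ n - X ^ (n % p) := by
    rw [mul_sub, mul_one, ← pow_mul, ← pow_add, Nat.mod_add_div]
  rw [← h]
  exact dvd_mul_of_dvd_right (sub_one_dvd_pow_sub_one _ _) _

/-- Folding a monomial: `(C a · X^n) mod (X^p − 1) = C a · X^(n mod p)` for `0 < p`. -/
theorem tct_fold_monomial (p : ℕ) (hp : 0 < p) (a : K) (n : ℕ) :
    (C a * X ^ n) %ₘ ((X : K[X]) ^ p - 1) = C a * X ^ (n % p) := by
  have hmonic : ((X : K[X]) ^ p - 1).Monic :=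
    monic_X_pow_sub (by rw [degree_one]; exact_mod_cast hp)
  have hdvd : (X : K[X]) ^ p - 1 ∣ C a * X ^ n - C a * X ^ (n % p) := by
    rw [← mul_sub]; exact dvd_mul_of_dvd_right (tct_X_pow_sub_one_dvd p n) _
  rw [modByMonic_eq_of_dvd_sub hmonic hdvd]
  refine (modByMonic_eq_self_iff hmonic).2 ?_
  have hdegq : ((X : K[X]) ^ p - 1).degree = p := by
    rw [← C_1, degree_X_pow_sub_C hp]
  rw [hdegq]
  refine lt_of_le_of_lt (degree_C_mul_X_pow_le _ _) ?_
  exact_mod_cast Nat.mod_lt n hp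

/-- **Folding does not increase the support**: `#supp (f mod (X^p − 1)) ≤ #supp f` (`0 < p`). -/
theorem card_support_fold_le (p : ℕ) (hp : 0 < p) (f : K[X]) :
    (f %ₘ ((X : K[X]) ^ p - 1)).support.card ≤ f.support.card := by
  have hsum : f %ₘ ((X : K[X]) ^ p - 1)
      = ∑ n ∈ f.support, C (f.coeff n) * X ^ (n % p) := by
    conv_lhs => rw [as_sum_support_C_mul_X_pow f]
    rw [← modByMonicHom_apply, map_sum]
    refine Finset.sum_congr rfl fun n _ => ?_
    rw [modByMonicHom_apply, tct_fold_monomial p hp]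
  rw [hsum]
  have h1 : ∀ n ∈ f.support, (fun m => (C (f.coeff m) * X ^ (m % p)).support.card) n ≤ (fun _ => 1) n :=
    fun n _ => card_support_C_mul_X_pow_le_one
  have h2 := Finset.sum_le_sum h1
  simp only [sum_const, smul_eq_mul, mul_one] at h2
  exact (socle_card_support_sum_le _ _).trans h2

/-- **Support of a folded weighted sum of squares**: `#supp ((Σ c_i g_i²) mod (X^p − 1)) ≤ Σ_i (#supp g_i)²`. -/
theorem card_support_sos_fold_le (p : ℕ) (hp : 0 < p) (s : ℕ) (c : Fin s → K) (g : Fin s → K[X]) :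
    ((∑ i, C (c i) * g i ^ 2) %ₘ ((X : K[X]) ^ p - 1)).support.card
      ≤ ∑ i, (g i).support.card ^ 2 := by
  refine (card_support_fold_le p hp _).trans ((socle_card_support_sum_le _ _).trans ?_)
  refine sum_le_sum fun i _ => ?_
  calc (C (c i) * g i ^ 2).support.card
      ≤ (g i ^ 2).support.card := by
        rw [C_mul']; exact Finset.card_le_card (support_smul (c i) (g i ^ 2))
    _ = (g i * g i).support.card := by rw [sq]
    _ ≤ (g i).support.card * (g i).support.card := card_support_mul_le
    _ = (g i).support.card ^ 2 := (sq _).symm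

end Support

/-- **Two-cusp depth, trivial exponent.**  If the fold `P = (Σ c_i g_i²) mod (X^p − 1)` is non-zero and
deep `≥ D` at the LOWER cusp (`P_0 = 0` for `D ≥ 1`, and `Σ_{n<p} P_n n^{p−1−d} = 0` for `1 ≤ d < D`), then
`D ≤ #supp P ≤ Σ_i (#supp g_i)² ≤ (Σ_i #supp g_i)²`.  (The upper-cusp hypothesis is not even needed.) -/
theorem twoCusp_depth_le_card_support_sq (K : Type) [Field K] (p : ℕ) [Fact p.Prime] [CharP K p]
    (s : ℕ) (c : Fin s → K) (g : Fin s → K[X]) (P : K[X]) (D : ℕ)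
    (hP : P = (∑ i, C (c i) * g i ^ 2) %ₘ (X ^ p - 1)) (hP0 : P ≠ 0)
    (h0 : 1 ≤ D → P.coeff 0 = 0)
    (hmom : ∀ d : ℕ, 1 ≤ d → d < D →
      ∑ n ∈ Finset.range p, P.coeff n * (n : K) ^ (p - 1 - d) = 0) :
    D ≤ P.support.card ∧ P.support.card ≤ ∑ i, (g i).support.card ^ 2 ∧
      (∑ i, (g i).support.card ^ 2) ≤ (∑ i, (g i).support.card) ^ 2 := by
  have hprime : p.Prime := Fact.out
  have hp : 0 < p := hprime.pos
  have hmonic : ((X : K[X]) ^ p - 1).Monic :=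
    monic_X_pow_sub (by rw [degree_one]; exact_mod_cast hp)
  have hdeg : P.natDegree < p := by
    have hq1 : ((X : K[X]) ^ p - 1) ≠ 1 := by
      intro h
      have := congrArg natDegree h
      rw [← C_1, natDegree_X_pow_sub_C, natDegree_C] at this
      omega
    have h := natDegree_modByMonic_lt (∑ i, C (c i) * g i ^ 2) hmonic hq1
    rw [← C_1, natDegree_X_pow_sub_C] at h
    rw [hP, ← C_1]; exact h
  refine ⟨stub_twoCuspHajos K p P D hP0 hdeg h0 hmom, ?_, ?_⟩
  · rw [hP]; exact card_support_sos_fold_le p hp s c g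
  · -- Σ t_i² ≤ (Σ t_i)²
    have key : ∀ (l : List ℕ), (l.map fun t => t ^ 2).sum ≤ l.sum ^ 2 := by
      intro l
      induction l with
      | nil => simp
      | cons a l ih =>
        simp only [List.map_cons, List.sum_cons]
        nlinarith [Nat.zero_le (a * l.sum)]
    have h1 : (∑ i, (g i).support.card ^ 2)
        = ((List.ofFn fun i => (g i).support.card).map fun t => t ^ 2).sum := by
      rw [List.map_ofFn, List.sum_ofFn]; rfl
    have h2 : (∑ i, (g i).support.card) = (List.ofFn fun i => (g i).support.card).sum := by
      rw [List.sum_ofFn]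
    rw [h1, h2]; exact key _

/-- **The two-cusp inequality with the trivial exponent `θ = 2`** (`C₀ = 1`, `A₀ = 0`), in the real-number
shape of the registered load-bearing stub `stub_twoCuspInequality` (which asks for some `θ < 2`). -/
theorem twoCuspInequality_theta_two :
    ∀ (K : Type) [Field K] (p : ℕ) [Fact p.Prime] [CharP K p]
      (s : ℕ) (c : Fin s → K) (g : Fin s → K[X]) (P : K[X]) (D : ℕ),
      (∀ i, (g i).natDegree < p) →
      P = (∑ i, C (c i) * g i ^ 2) %ₘ (X ^ p - 1) →
      P ≠ 0 →
      (X - C (1 : K)) ^ D ∣ P →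
      (1 ≤ D → P.coeff 0 = 0) →
      (∀ d : ℕ, 1 ≤ d → d < D → ∑ n ∈ Finset.range p, P.coeff n * (n : K) ^ (p - 1 - d) = 0) →
      (D : ℝ) ≤ 1 * ((s : ℝ) + 1) ^ (0 : ℕ) * ((∑ i, (g i).support.card : ℕ) : ℝ) ^ (2 : ℝ) := by
  intro K _ p _ _ s c g P D _ hP hP0 _ h0 hmom
  obtain ⟨h1, h2, h3⟩ := twoCusp_depth_le_card_support_sq K p s c g P D hP hP0 h0 hmom
  rw [one_mul, pow_zero, one_mul, Real.rpow_two]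
  exact_mod_cast h1.trans (h2.trans h3)

end Summit.ValiantsHypothesis.ValiantsHypothesis.Theorems.CharPSparseSOSTwoCusp
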